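import Summits.HodgeConjecture.HodgeConjecture.Theorems.F0P5CurveThetaCompanionRelabelOfLocalFactors
import Literature.NumberTheory.Automorphic.Liu2021.LemD1Item1AtV2OfSplit
import Literature.NumberTheory.GelbartRogawski1991.UndoubledSplittingsUnitary
import Literature.NumberTheory.Automorphic.QuadraticNonsplitPlaceOfNotIsSquare
import HarnessLib

/-!
# Crux `HLiu418`, line `F0_P5_CurveThetaLettersPaydown` — stub **R2′** `CompanionRelabelTransfer₂` modulo BOTH letters at the NON-SPLIT places only
# (the `h1` CUT: [Liu2021, Lem. D.1 (1)] for the companion package is needed only where `L/L⁺` is non-split; the split half is in-house)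

Cell hodgecm-mathlib (D-0151), FLOOR 0, P5 (Alb-CM), crux `HLiu418` = stmt-HodgeConjecture-24832; pay-down line
`Cruxes/HLiu418/Lines/F0_P5_CurveThetaLettersPaydown.lean` (ED. 4, commit 8bf3c2954181), stub R2′ `stub_sl_companionRelabelTransfer : CompanionRelabelTransfer₂`.
Sibling of ★ `F0P5CurveThetaCompanionRelabelOfLocalFactors` (p830748; seat A-p17 (g18); that file is at the 400-line cap, hence a new module).  THEOREMS
ONLY; `--supports stmt-HodgeConjecture-24832`.  HONEST LABEL: HC_CM is proved only modulo the printed citations — the 2 remaining named inputs (hLiu418, h413) —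
until rung 0 closes; this file retires no letter: it SHRINKS the second letter of ★ `companionRelabelTransfer₂_of_nonsplit_lemD1_4` (there `h1` = [Liu2021,
Lem. D.1 (1)] AS PRINTED for the companion package `(λ′, a′, χ)` at EVERY finite place) to the NON-SPLIT places (`h1ns`: the same text behind the extra
hypothesis `∀ w ∣ v, 𝔠 • w = w`, the token of `h4`), the SPLIT half being the in-house theorem ★ `lemD1_1AsPrintedLocalLemD1DataAtV₂_of_not_isField`
(B-p04 (g30), p830397: split model `U(V)(L⁺_v) ≅ GL₂`, irreducible unitary principal series) whose unitarity input `hL2` is ★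
`isL2Isometric_omegaLoc_congrW_undoubledSplittings_cmFinLocalFamily` (the CM package IS `L²`-isometric for the Borel σ-algebra and a Haar measure on `L⁺_v`)
and whose `¬ IsField (L ⊗ L⁺_v)` is ★ `not_isField_localRing_of_ne` at the two places `w ≠ 𝔠 • w`.  F0P5-plan (g4) 2026-08-31T17:58:29Z (1): «the cleanest
letters are BOTH non-split-only».

* §1 `lemD1_1AsPrinted_companion_of_nonsplit_letter` — at ONE place `v`: the non-split-only reading of (1) implies the all-places reading;
* §2 **`companionRelabelTransfer₂_of_nonsplit_letters (h4) (h1ns)`** — the registered signature of `CompanionRelabelTransfer₂` UNFOLDED verbatim, from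
  `h4` (= the binder of ★ `companionRelabelTransfer₂_of_nonsplit_lemD1_4`, [Liu2021, Lem. D.1 (4)] AS PRINTED on the two members at the non-split places)
  and `h1ns`; ED. 5∕6 fold: `theorem stub_sl_companionRelabelTransfer : CompanionRelabelTransfer₂ :=
  F0P5CurveThetaCompanionRelabelOfNonsplitLetters.companionRelabelTransfer₂_of_nonsplit_letters stub_letter_lemD14_nonsplit stub_letter_lemD11_nonsplit`.

## References
* [Liu2021] Y. Liu, *Fourier–Jacobi cycles and arithmetic relative trace formula*, Camb. J. Math. 9 (2021) = arXiv:2102.11518: App. D §D.1 Steps 1–3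
  (l. 5213–5224), Lem. D.1 (1) (l. 5227–5229) and its proof, first paragraph (l. 5241, the split case `E = F × F`), (4) (l. 5235); Rem. 4.4.
* [CasselsFrohlichANT1967] J. W. S. Cassels, A. Fröhlich (eds.), *Algebraic Number Theory*, Ch. II §10 (`L ⊗_K K_v = Π_{w∣v} L_w`).
* [Flath1979] D. Flath, *Decomposition of representations into tensor products*, Proc. Sympos. Pure Math. 33 (1979), part 1, §2 Example 2.
-/

set_option autoImplicit false

-- the mandated namespace has the single-problem summit's repeated segment (`HodgeConjecture.HodgeConjecture`)
set_option linter.dupNamespace false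

noncomputable section

open scoped Matrix Kronecker RestrictedProduct NumberField TensorProduct
open NumberField NumberField.mixedEmbedding IsDedekindDomain Filter
open Literature.NumberTheory Literature.NumberTheory.Automorphic Literature.NumberTheory.Automorphic.UnitaryGroup
open Literature.NumberTheory.GelbartRogawski1991 Literature.NumberTheory.GelbartRogawski1991.UnitaryDualPair
open Literature.NumberTheory.GelbartRogawski1991.UnitaryDualPair.WeilCoinv
open Literature.NumberTheory.GelbartRogawski1991.UnitaryDualPair.LocalSplitting
open Literature.NumberTheory.GelbartRogawski1991.GRConstruction
open Literature.NumberTheory.Weil1964 Literature.RepresentationTheory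
open Literature.RepresentationTheory.HeisenbergGroup
open Literature.NumberTheory.GaloisRepresentations Literature.RepresentationTheory.HarrisKudlaSweet1996
open Literature.NumberTheory.Automorphic.IdeleClassGroup Literature.RepresentationTheory.Liu2021
open Literature.NumberTheory.Automorphic.Liu2021 Literature.NumberTheory.Automorphic.Liu2021.Def411WeilCarriers
open Literature.NumberTheory.Automorphic.Liu2021.Def411WeilCarriersDoubling
open NumberField.InfinitePlace
open scoped ComplexOrder
open Literature.NumberTheory.ComplexMultiplication (CMTypeOps.bar CMTypeOps.mem_bar_iff)
open Summit.HodgeConjecture.HodgeConjecture.Cruxes.HLiu418.F0P5CurveThetaCompanionRelabelOfLocalFactors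
open _root_.MeasureTheory

namespace Summit.HodgeConjecture.HodgeConjecture.Cruxes.HLiu418.F0P5CurveThetaCompanionRelabelOfNonsplitLetters

variable (L : Type) [Field L] [NumberField L] [IsCMField L]

/-! ## §1 [Liu2021, Lem. D.1 (1)] for the companion package: the non-split-only reading implies the all-places reading -/

section Cut

variable {n' : ℕ} (e₁ : Fin 2 × Fin 1 ≃ Fin n') (dV : Fin 2 → L) (hdV : ∀ i, IsCMField.complexConj L (dV i) = dV i) (hdV0 : ∀ i, dV i ≠ 0)
  (χ : Chi (Fp L) L (IsCMField.complexConj L)) (a' : (Fp L)ˣ)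
  (lam' : Literature.NumberTheory.Automorphic.IdeleClassGroup L →ₜ* Circle) (hlam' : IsConjugateSymplectic L lam')
  (v : HeightOneSpectrum (𝓞 (Fp L)))

/-- **[Liu2021, Lem. D.1 (1)] AS PRINTED for the companion package `(λ′, a′, χ)` at `v`: the NON-SPLIT-only letter suffices** — if `v` splits in `L`
(some `w ∣ v` with `𝔠 • w ≠ w`, so `L ⊗ L⁺_v` is not a field, ★ `not_isField_localRing_of_ne`) the record holds IN-HOUSE by ★
`lemD1_1AsPrinted_localLemD1DataAtV₂_of_not_isField` (split model), its unitarity input supplied by ★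
`isL2Isometric_omegaLoc_congrW_undoubledSplittings_cmFinLocalFamily` for the Borel σ-algebra and the Haar measure `addHaar` on `L⁺_v`.
[cite: Liu2021, App. D Lemma D.1 (1) (l. 5227–5229); proof of Lemma D.1, first paragraph (l. 5241)] [cite: CasselsFrohlichANT1967, Ch. II §10] -/
theorem lemD1_1AsPrinted_companion_of_nonsplit_letter
    (h1v : (∀ w : UnitaryGroup.PlacesOver L v, IsCMField.complexConj L • (w : HeightOneSpectrum (𝓞 L)) = w) →
      LemD1_1AsPrinted (localLemD1DataAtV₂ (Fp L) L (IsCMField.complexConj L) 2 e₁ (Matrix.diagonal dV) (complexConj_imagUnit L) (imagUnit_ne_zero L) (imagUnit_mul_self L) (realDiagonal_isSymm L dV hdV) (isUnit_det_realDiagonal L dV hdV hdV0) (realDiagonal_map L dV hdV).symm a' (congrW L e₁ dV hdV (lineW L (TW (Fp L) a')) (complexConj_lineW L (TW (Fp L) a')) (realDiagonal_lineW L (TW (Fp L) a')) (diagonal_lineW L (TW (Fp L) a') (JW_eq (Fp L) L a')) (undoubledSplittings L e₁ dV hdV hdV0 (lineW L (TW (Fp L) a')) (complexConj_lineW L (TW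 (Fp L) a')) (lineW_ne_zero L (TW (Fp L) a') (isUnit_det_TW (Fp L) a')) (toHeckeCharacter L lam') (borelPlaceMeasure L) (cmFinLocalFamily L e₁ dV hdV hdV0 (lineW L (TW (Fp L) a')) (complexConj_lineW L (TW (Fp L) a')) (lineW_ne_zero L (TW (Fp L) a') (isUnit_det_TW (Fp L) a')) (toHeckeCharacter L lam') ((isOscillatorChar_toHeckeCharacter_iff lam').mpr hlam') (borelPlaceMeasure L))) (isSymm_TW (Fp L) a') (JW_eq (Fp L) L a')) (two_le_of_finTwo_equiv e₁) (localMu L (toHeckeCharacter L lam')) (fun v x => norm_localMu L (toHeckeCharacter L lam') v (isUnitary_toHeckeCharacter L lam') x) (continuous_localMu L (toHeckeCharacter L lam')) (fun v t => localMu_toLocalRing_eq_one_iff L (toHeckeCharacter L lam') v ((isOscillatorChar_toHeckeCharacter_iff lam').mpr hlam') t) χ v)) :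
    LemD1_1AsPrinted (localLemD1DataAtV₂ (Fp L) L (IsCMField.complexConj L) 2 e₁ (Matrix.diagonal dV) (complexConj_imagUnit L) (imagUnit_ne_zero L) (imagUnit_mul_self L) (realDiagonal_isSymm L dV hdV) (isUnit_det_realDiagonal L dV hdV hdV0) (realDiagonal_map L dV hdV).symm a' (congrW L e₁ dV hdV (lineW L (TW (Fp L) a')) (complexConj_lineW L (TW (Fp L) a')) (realDiagonal_lineW L (TW (Fp L) a')) (diagonal_lineW L (TW (Fp L) a') (JW_eq (Fp L) L a')) (undoubledSplittings L e₁ dV hdV hdV0 (lineW L (TW (Fp L) a')) (complexConj_lineW L (TW (Fp L) a')) (lineW_ne_zero L (TW (Fp L) a') (isUnit_det_TW (Fp L) a')) (toHeckeCharacter L lam') (borelPlaceMeasure L) (cmFinLocalFamily L e₁ dV hdV hdV0 (lineW L (TW (Fp L) a')) (complexConj_lineW L (TW (Fp L) a')) (lineW_ne_zero L (TW (Fp L) a') (isUnit_det_TW (Fp L) a')) (toHeckeCharacter L lam') ((isOscillatorChar_toHeckeCharacter_iff lam').mpr hlam') (borelPlaceMeasure L))) (isSymm_TW (Fp L) a')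 (JW_eq (Fp L) L a')) (two_le_of_finTwo_equiv e₁) (localMu L (toHeckeCharacter L lam')) (fun v x => norm_localMu L (toHeckeCharacter L lam') v (isUnitary_toHeckeCharacter L lam') x) (continuous_localMu L (toHeckeCharacter L lam')) (fun v t => localMu_toLocalRing_eq_one_iff L (toHeckeCharacter L lam') v ((isOscillatorChar_toHeckeCharacter_iff lam').mpr hlam') t) χ v) := by
  by_cases hns : ∀ w : UnitaryGroup.PlacesOver L v, IsCMField.complexConj L • (w : HeightOneSpectrum (𝓞 L)) = w
  · exact h1v hns
  · push Not at hns
    obtain ⟨w, hw⟩ := hns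
    have hF : ¬ IsField (LocalRing L v) :=
      not_isField_localRing_of_ne L v w ⟨IsCMField.complexConj L • w.1, by rw [HeightOneSpectrum.under_algEquiv_smul]; exact w.2⟩
        (fun h => hw (congrArg Subtype.val h))
    letI : MeasurableSpace (v.adicCompletion (Fp L)) := borel _
    haveI : BorelSpace (v.adicCompletion (Fp L)) := ⟨rfl⟩
    exact lemD1_1AsPrinted_localLemD1DataAtV₂_of_not_isField (Fp L) L (IsCMField.complexConj L) 2 e₁ (Matrix.diagonal dV)
      (complexConj_imagUnit L) (imagUnit_ne_zero L) (imagUnit_mul_self L) (realDiagonal_isSymm L dV hdV) (isUnit_det_realDiagonal L dV hdV hdV0)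
      (realDiagonal_map L dV hdV).symm a' (congrW L e₁ dV hdV (lineW L (TW (Fp L) a')) (complexConj_lineW L (TW (Fp L) a')) (realDiagonal_lineW L (TW (Fp L) a')) (diagonal_lineW L (TW (Fp L) a') (JW_eq (Fp L) L a')) (undoubledSplittings L e₁ dV hdV hdV0 (lineW L (TW (Fp L) a')) (complexConj_lineW L (TW (Fp L) a')) (lineW_ne_zero L (TW (Fp L) a') (isUnit_det_TW (Fp L) a')) (toHeckeCharacter L lam') (borelPlaceMeasure L) (cmFinLocalFamily L e₁ dV hdV hdV0 (lineW L (TW (Fp L) a')) (complexConj_lineW L (TW (Fp L) a')) (lineW_ne_zero L (TW (Fp L) a') (isUnit_det_TW (Fp L) a')) (toHeckeCharacter L lam') ((isOscillatorChar_toHeckeCharacter_iff lam').mpr hlam') (borelPlaceMeasure L))) (isSymm_TW (Fp L) a') (JW_eq (Fp L) L a')) (two_le_of_finTwo_equiv e₁)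
      (localMu L (toHeckeCharacter L lam')) (fun v x => norm_localMu L (toHeckeCharacter L lam') v (isUnitary_toHeckeCharacter L lam') x)
      (continuous_localMu L (toHeckeCharacter L lam'))
      (fun v t => localMu_toLocalRing_eq_one_iff L (toHeckeCharacter L lam') v ((isOscillatorChar_toHeckeCharacter_iff lam').mpr hlam') t) χ v hF
      Measure.addHaar
      (isL2Isometric_omegaLoc_congrW_undoubledSplittings_cmFinLocalFamily L e₁ dV hdV hdV0 (lineW L (TW (Fp L) a')) (complexConj_lineW L (TW (Fp L) a'))
        (lineW_ne_zero L (TW (Fp L) a') (isUnit_det_TW (Fp L) a')) (toHeckeCharacter L lam') ((isOscillatorChar_toHeckeCharacter_iff lam').mpr hlam')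
        (borelPlaceMeasure L) v (isUnitary_toHeckeCharacter L lam') (realDiagonal_lineW L (TW (Fp L) a')) (diagonal_lineW L (TW (Fp L) a') (JW_eq (Fp L) L a'))
        (isSymm_TW (Fp L) a') (JW_eq (Fp L) L a') Measure.addHaar)

end Cut

/-! ## §2 THE ASSEMBLY with BOTH letters at the non-split places only -/

/-- **Stub R2′ `CompanionRelabelTransfer₂` CLOSED MODULO THE TWO NON-SPLIT-ONLY AS-PRINTED LETTERS** (registered signature UNFOLDED verbatim): `h4` =
[Liu2021, Lem. D.1 (4)] AS PRINTED on the members `(λ, a, χ)`, `(λ′, a′, χ)` at the non-split places (the binder of ★ `companionRelabelTransfer₂_of_nonsplit_lemD1_4`),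
`h1ns` = [Liu2021, Lem. D.1 (1)] AS PRINTED for `(λ′, a′, χ)` at the NON-SPLIT places; the all-places `h1` of ★ is recovered place by place by §1.
[cite: Liu2021, App. D Lem. D.1 (1), (4) (p. 125–126) and its proof (p. 126–127); Rem. 4.4] [cite: Flath1979, §2 Example 2] -/
theorem companionRelabelTransfer₂_of_nonsplit_letters
    (h4 : ∀ (L : Type) [Field L] [NumberField L] [IsCMField L]
      (dV : Fin 2 → L) (hdV : ∀ i, IsCMField.complexConj L (dV i) = dV i) (hdV0 : ∀ i, dV i ≠ 0)
      {n' : ℕ} (e₁ : Fin 2 × Fin 1 ≃ Fin n')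
      (lam : Literature.NumberTheory.Automorphic.IdeleClassGroup L →ₜ* Circle) (hlam : IsConjugateSymplectic L lam)
      (a : (↥(maximalRealSubfield L))ˣ) (χ : Chi (↥(maximalRealSubfield L)) L (IsCMField.complexConj L)) (a' : (↥(maximalRealSubfield L))ˣ)
      (lam' : Literature.NumberTheory.Automorphic.IdeleClassGroup L →ₜ* Circle) (hlam' : IsConjugateSymplectic L lam')
      (hcc : IsCMField.complexConj L * IsCMField.complexConj L = 1),
      toHeckeCharacter L lam' =
        toHeckeCharacter L (IdeleClassGroup.galConj (IsCMField.complexConj L) lam) * HeckeCharacter.checkOfChi hcc χ →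
    ∀ (v : HeightOneSpectrum (𝓞 ↥(maximalRealSubfield L))),
      (∀ w : UnitaryGroup.PlacesOver L v, IsCMField.complexConj L • (w : HeightOneSpectrum (𝓞 L)) = w) →
      LemD1_4AsPrintedI (localIndexedFamilyAtV₂ (Fp L) L (IsCMField.complexConj L) 2 e₁ (Matrix.diagonal dV) (complexConj_imagUnit L) (imagUnit_ne_zero L) (imagUnit_mul_self L) (realDiagonal_isSymm L dV hdV) (isUnit_det_realDiagonal L dV hdV hdV0) (realDiagonal_map L dV hdV).symm (two_le_of_finTwo_equiv e₁) ![a, a'] (fun _ => χ) (Fin.cons (α := fun i : Fin 2 => LocalSplitting.FinLocalSplittings (Fp L) L (IsCMField.complexConj L) n' (complexConj_imagUnit L) (imagUnit_ne_zero L) (imagUnit_mul_self L) (gram (Fp L) e₁ (realDiagonal L dV hdV) (TW (Fp L) (![a, a'] i))) (isSymm_gram (Fp L) e₁ (realDiagonal_isSymm L dV hdV) (isSymm_TW (Fp L) (![a, a'] i))) (reindex_kronecker_eq_gram_map (Fp L) L e₁ (realDiagonal_map L dV hdV).symm (JW_eq (Fp L) L (![a, a'] i)))) (congrW L e₁ dV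 hdV (lineW L (TW (Fp L) a)) (complexConj_lineW L (TW (Fp L) a)) (realDiagonal_lineW L (TW (Fp L) a)) (diagonal_lineW L (TW (Fp L) a) (JW_eq (Fp L) L a)) (undoubledSplittings L e₁ dV hdV hdV0 (lineW L (TW (Fp L) a)) (complexConj_lineW L (TW (Fp L) a)) (lineW_ne_zero L (TW (Fp L) a) (isUnit_det_TW (Fp L) a)) (toHeckeCharacter L lam) (borelPlaceMeasure L) (cmFinLocalFamily L e₁ dV hdV hdV0 (lineW L (TW (Fp L) a)) (complexConj_lineW L (TW (Fp L) a)) (lineW_ne_zero L (TW (Fp L) a) (isUnit_det_TW (Fp L) a)) (toHeckeCharacter L lam) ((isOscillatorChar_toHeckeCharacter_iff lam).mpr hlam) (borelPlaceMeasure L))) (isSymm_TW (Fp L) a) (JW_eq (Fp L) L a)) (Fin.cons (congrW L e₁ dV hdV (lineW L (TW (Fp L) a')) (complexConj_lineW L (TW (Fp L) a')) (realDiagonal_lineW L (TW (Fp L) a')) (diagonal_lineW L (TW (Fp L) a') (JW_eq (Fp L) L a')) (undoubledSplittings L e₁ dV hdV hdV0 (lineW L (TW (Fp L) a')) (complexConj_lineW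 L (TW (Fp L) a')) (lineW_ne_zero L (TW (Fp L) a') (isUnit_det_TW (Fp L) a')) (toHeckeCharacter L lam') (borelPlaceMeasure L) (cmFinLocalFamily L e₁ dV hdV hdV0 (lineW L (TW (Fp L) a')) (complexConj_lineW L (TW (Fp L) a')) (lineW_ne_zero L (TW (Fp L) a') (isUnit_det_TW (Fp L) a')) (toHeckeCharacter L lam') ((isOscillatorChar_toHeckeCharacter_iff lam').mpr hlam') (borelPlaceMeasure L))) (isSymm_TW (Fp L) a') (JW_eq (Fp L) L a')) finZeroElim)) ![localMu L (toHeckeCharacter L lam), localMu L (toHeckeCharacter L lam')] (norm_localMu_pair L lam lam') (continuous_localMu_pair L lam lam') (localMu_pair_toLocalRing_eq_one_iff L lam hlam lam' hlam') v))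
    (h1ns : ∀ (L : Type) [Field L] [NumberField L] [IsCMField L]
      (dV : Fin 2 → L) (hdV : ∀ i, IsCMField.complexConj L (dV i) = dV i) (hdV0 : ∀ i, dV i ≠ 0)
      {n' : ℕ} (e₁ : Fin 2 × Fin 1 ≃ Fin n')
      (χ : Chi (↥(maximalRealSubfield L)) L (IsCMField.complexConj L)) (a' : (↥(maximalRealSubfield L))ˣ)
      (lam' : Literature.NumberTheory.Automorphic.IdeleClassGroup L →ₜ* Circle) (hlam' : IsConjugateSymplectic L lam')
      (v : HeightOneSpectrum (𝓞 ↥(maximalRealSubfield L))),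
      (∀ w : UnitaryGroup.PlacesOver L v, IsCMField.complexConj L • (w : HeightOneSpectrum (𝓞 L)) = w) →
      LemD1_1AsPrinted (localLemD1DataAtV₂ (Fp L) L (IsCMField.complexConj L) 2 e₁ (Matrix.diagonal dV) (complexConj_imagUnit L) (imagUnit_ne_zero L) (imagUnit_mul_self L) (realDiagonal_isSymm L dV hdV) (isUnit_det_realDiagonal L dV hdV hdV0) (realDiagonal_map L dV hdV).symm a' (congrW L e₁ dV hdV (lineW L (TW (Fp L) a')) (complexConj_lineW L (TW (Fp L) a')) (realDiagonal_lineW L (TW (Fp L) a')) (diagonal_lineW L (TW (Fp L) a') (JW_eq (Fp L) L a')) (undoubledSplittings L e₁ dV hdV hdV0 (lineW L (TW (Fp L) a')) (complexConj_lineW L (TW (Fp L) a')) (lineW_ne_zero L (TW (Fp L) a') (isUnit_det_TW (Fp L) a')) (toHeckeCharacter L lam') (borelPlaceMeasure L) (cmFinLocalFamily L e₁ dV hdV hdV0 (lineW L (TW (Fp L) a')) (complexConj_lineW L (TW (Fp L) a')) (lineW_ne_zero L (TW (Fp L) a') (isUnit_det_TW (Fp L) a')) (toHeckeCharacter L lam')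 ((isOscillatorChar_toHeckeCharacter_iff lam').mpr hlam') (borelPlaceMeasure L))) (isSymm_TW (Fp L) a') (JW_eq (Fp L) L a')) (two_le_of_finTwo_equiv e₁) (localMu L (toHeckeCharacter L lam')) (fun v x => norm_localMu L (toHeckeCharacter L lam') v (isUnitary_toHeckeCharacter L lam') x) (continuous_localMu L (toHeckeCharacter L lam')) (fun v t => localMu_toLocalRing_eq_one_iff L (toHeckeCharacter L lam') v ((isOscillatorChar_toHeckeCharacter_iff lam').mpr hlam') t) χ v)) :
  ∀ (L : Type) [Field L] [NumberField L] [IsCMField L] (ι : L →+* ℂ) (H : Matrix (Fin 2) (Fin 2) L)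
    (dV : Fin 2 → L) (hdV : ∀ i, IsCMField.complexConj L (dV i) = dV i) (hdV0 : ∀ i, dV i ≠ 0)
    (t : L) (ht : t ≠ 0) (g : GL (Fin 2) L)
    (hg : formCongr ((IsCMField.complexConj L : L ≃ₐ[↥(maximalRealSubfield L)] L) : L →+* L) g (t • H) = Matrix.diagonal dV),
    (∃ T : GL (Fin 2) ℂ, formCongr (starRingEnd ℂ) T ((Matrix.diagonal dV).map ι) = Matrix.diagonal ![(1 : ℂ), -1]) →
    (∀ τ' : L →+* ℂ, InfinitePlace.mk τ' ≠ InfinitePlace.mk ι → ((Matrix.diagonal dV).map τ').PosDef) →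
    4 ≤ Module.finrank ℚ L →
    ∀ {n' : ℕ} (e₁ : Fin 2 × Fin 1 ≃ Fin n')
      (lam : Literature.NumberTheory.Automorphic.IdeleClassGroup L →ₜ* Circle) (hlam : IsConjugateSymplectic L lam), HasWeight L lam 1 →
    ∀ (a : (↥(maximalRealSubfield L))ˣ) (χ : Chi (↥(maximalRealSubfield L)) L (IsCMField.complexConj L))
      (W : Type) [AddCommGroup W] [Module ℂ W]
      (σ : Representation ℂ (finAdelic (↥(maximalRealSubfield L)) L (IsCMField.complexConj L) 2 H) W),
      σ.IsIrreducible → σ.IsSmooth →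
    ∀ j : σ.IntertwiningMap
        ((rhoVAtLine (↥(maximalRealSubfield L)) L (IsCMField.complexConj L) 2 e₁ (Matrix.diagonal dV)
            (complexConj_imagUnit L) (imagUnit_ne_zero L) (imagUnit_mul_self L) (realDiagonal_isSymm L dV hdV)
            (isUnit_det_realDiagonal L dV hdV hdV0) (realDiagonal_map L dV hdV).symm
            (fun a => isCompatible_chiSplittingLine L e₁ dV hdV hdV0 (toHeckeCharacter L lam)
              (isUnitary_toHeckeCharacter L lam) ((isOscillatorChar_toHeckeCharacter_iff lam).mpr hlam)
              (TW (↥(maximalRealSubfield L)) a) (isSymm_TW (↥(maximalRealSubfield L)) a)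
              (isUnit_det_TW (↥(maximalRealSubfield L)) a) (JW (↥(maximalRealSubfield L)) L a)
              (JW_eq (↥(maximalRealSubfield L)) L a)) a χ).comp
          (finAdelicCongr (↥(maximalRealSubfield L)) L (IsCMField.complexConj L) g ht hg).symm.toMonoidHom),
      Function.Injective j →
    ∀ a' : (↥(maximalRealSubfield L))ˣ,
      (∀ (hJh : ((Matrix.diagonal dV).map (IsCMField.complexConj L))ᵀ = Matrix.diagonal dV) (hJdet : (Matrix.diagonal dV).det ≠ 0)
          (v : HeightOneSpectrum (𝓞 ↥(maximalRealSubfield L))),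
        locF (↥(maximalRealSubfield L)) (imagUnitSq L) a' v = locF (↥(maximalRealSubfield L)) (imagUnitSq L) a v ↔
          LemD1.IsIsotropic (LemD1OfPlace.standingData L v (IsCMField.complexConj L) 2 (Matrix.diagonal dV)
            (complexConj_imagUnit L) (imagUnit_ne_zero L) le_rfl hJh hJdet)) →
      ∃ (lam' : Literature.NumberTheory.Automorphic.IdeleClassGroup L →ₜ* Circle) (hlam' : IsConjugateSymplectic L lam'),
        HasWeight L lam' 1 ∧ hlam'.cmType = CMTypeOps.bar hlam.cmType ∧
        ∃ j' : σ.IntertwiningMap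
            ((rhoVAtLine (↥(maximalRealSubfield L)) L (IsCMField.complexConj L) 2 e₁ (Matrix.diagonal dV)
                (complexConj_imagUnit L) (imagUnit_ne_zero L) (imagUnit_mul_self L) (realDiagonal_isSymm L dV hdV)
                (isUnit_det_realDiagonal L dV hdV hdV0) (realDiagonal_map L dV hdV).symm
                (fun a => isCompatible_chiSplittingLine L e₁ dV hdV hdV0 (toHeckeCharacter L lam') (isUnitary_toHeckeCharacter L lam')
                  ((isOscillatorChar_toHeckeCharacter_iff lam').mpr hlam')
                  (TW (↥(maximalRealSubfield L)) a) (isSymm_TW (↥(maximalRealSubfield L)) a)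
                  (isUnit_det_TW (↥(maximalRealSubfield L)) a) (JW (↥(maximalRealSubfield L)) L a)
                  (JW_eq (↥(maximalRealSubfield L)) L a)) a' χ).comp
              (finAdelicCongr (↥(maximalRealSubfield L)) L (IsCMField.complexConj L) g ht hg).symm.toMonoidHom),
          Function.Injective j'
    :=
  companionRelabelTransfer₂_of_nonsplit_lemD1_4 h4 fun L _ _ _ dV hdV hdV0 _ e₁ χ a' lam' hlam' v =>
    lemD1_1AsPrinted_companion_of_nonsplit_letter L e₁ dV hdV hdV0 χ a' lam' hlam' v (h1ns L dV hdV hdV0 e₁ χ a' lam' hlam' v)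

end Summit.HodgeConjecture.HodgeConjecture.Cruxes.HLiu418.F0P5CurveThetaCompanionRelabelOfNonsplitLetters

end
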